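import Mathlib
import Summits.ResolutionOfSingularities.ResolutionOfSingularities.Theorems.HomologicalConductorPersistenceArenaGeneralMiddle
import HarnessLib

/-!
# Crux `Persistence` (stmt-ResolutionOfSingularities-16484) / `StrictDrop` K-SD0 (stmt-…-16485) / rung S-2 — the cA ARENA in EVERY
# DIMENSION, part B: `(x, y) + ι(caⁿ⁺¹(k[z₁..z_{n+1}]/(h)))·T_h ≤ caⁿ⁺³(T_h)`, `T_h = k[x,y,z₁,…,z_{n+1}]/(xy − h)`, fact-free

Route `ResolutionOfSingularities/HomologicalConductor`, chain W4.4b (cell `res-hironaka`).  `[OURS · L1 w44b · res-L1-w44b-stub-2 gen 4]`; NOT a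
statement of the manuscript under review (Hironaka 2017), no statement of that manuscript is used; AI-written, weaker than expert review.

`…PersistenceArenaLower` (p541600, base `k[z,t]`) for an ARBITRARY number `n + 1` of base variables (res-L1-w44b-plan-1 CRUX-PLAN-SD-v0 (O3): the
K-SD0 arena `x₁x₂ = x₃⁹x₄⁵x₅` has base `k[x₃,x₄,x₅]`).  `S = MvPolynomial (Fin (n+3)) k` (`x = X 0`, `y = X 1`, `zⱼ = X j.succ.succ`),
`ι = aeval (X ∘ succ ∘ succ)`, `f = xy − ι h`, `T_h = S/(f)`; `σ : y ↦ x` onto `k[x,z] = MvPolynomial (Fin (n+2)) k`, `ι″ : x, zⱼ ↦ x, zⱼ`.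

Content: bookkeeping (`σ(ι h) = ι′ h`, `ι″(ι′ h) = ι h`, `σ ∘ ι″ = id`, `g − ι″(σ g) ∈ (x − y)`, `σ f = F′`, `ι″ F′ = f + x(x − y)`,
`∂_y f = x`, `∂ₓ f = y`, `f ≠ 0`); `x̄ − ȳ ∈ T_h⁰`, `x̄, ȳ ∈ caⁿ⁺³(T_h)` (KEPT-PROPER, `d = n + 2`); `T_h ↠ B_h` with kernel `(x̄ − ȳ)`;
**`mk_inclusion_mem_cohomologyAnnihilatorOfDegree`**: `c̄ ∈ caⁿ⁺¹(C_h) ⇒ (ι c)‾ ∈ caⁿ⁺³(T_h)` (`2 ≠ 0`, `h ≠ 0`); ideal and localised forms.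
References (mechanism only): res-L1-w44b-plan-1 CRUX-PLAN-SD-v0 (O3); Ö. Esentepe, J. Algebra 541 (2020) Thm 5.4 [`Esentepe2020`].
-/

noncomputable section

-- single-problem summit: the doubled namespace component `ResolutionOfSingularities` is forced
set_option linter.dupNamespace false

namespace Summit.ResolutionOfSingularities.ResolutionOfSingularities.Theorems.HomologicalConductor.ArenaGeneral

open MvPolynomial Literature.RingTheory.CohomologyAnnihilator
open Summit.ResolutionOfSingularities.ResolutionOfSingularities.Theorems.HomologicalConductor.PersistenceJacobianKept
open Summit.ResolutionOfSingularities.ResolutionOfSingularities.Theorems.HomologicalConductor.QuotientAscent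
open Summit.ResolutionOfSingularities.ResolutionOfSingularities.Theorems.HomologicalConductor.KC3Lower
open Summit.ResolutionOfSingularities.ResolutionOfSingularities.Theorems.HomologicalConductor.ArenaLowerMiddle
open Summit.ResolutionOfSingularities.ResolutionOfSingularities.Theorems.HomologicalConductor.ArenaGeneralMiddle
open scoped nonZeroDivisors

universe u

variable (k : Type u) [Field k] (n : ℕ)

/-! ## §1 Bookkeeping for `σ : y ↦ x`, `ι″`, `ι` -/
/-- `σ (ι h) = ι′ h`. [folklore] -/
theorem sigma_inclusion (h : MvPolynomial (Fin (n + 1)) k) :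
    (MvPolynomial.aeval (Fin.cons (X 0) (Fin.cons (X 0) fun j : Fin (n + 1) => X j.succ) :
        Fin (n + 3) → MvPolynomial (Fin (n + 2)) k))
        ((MvPolynomial.aeval (fun j : Fin (n + 1) => (X j.succ.succ : MvPolynomial (Fin (n + 3)) k))) h) =
      (MvPolynomial.aeval (fun j : Fin (n + 1) => (X j.succ : MvPolynomial (Fin (n + 2)) k))) h := by
  have hc : (MvPolynomial.aeval (Fin.cons (X 0) (Fin.cons (X 0) fun j : Fin (n + 1) => X j.succ) :
        Fin (n + 3) → MvPolynomial (Fin (n + 2)) k)).comp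
      (MvPolynomial.aeval (fun j : Fin (n + 1) => (X j.succ.succ : MvPolynomial (Fin (n + 3)) k))) =
      MvPolynomial.aeval (fun j : Fin (n + 1) => (X j.succ : MvPolynomial (Fin (n + 2)) k)) := by
    refine MvPolynomial.algHom_ext fun j => ?_
    simp [Fin.cons_succ]
  exact AlgHom.congr_fun hc h

/-- `ι″ (ι′ h) = ι h`. [folklore] -/
theorem inclusion_inclusion (h : MvPolynomial (Fin (n + 1)) k) :
    (MvPolynomial.aeval (Fin.cons (X 0) fun j : Fin (n + 1) => (X j.succ.succ : MvPolynomial (Fin (n + 3)) k)))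
        ((MvPolynomial.aeval (fun j : Fin (n + 1) => (X j.succ : MvPolynomial (Fin (n + 2)) k))) h) =
      (MvPolynomial.aeval (fun j : Fin (n + 1) => (X j.succ.succ : MvPolynomial (Fin (n + 3)) k))) h := by
  have hc : (MvPolynomial.aeval (Fin.cons (X 0) fun j : Fin (n + 1) => (X j.succ.succ : MvPolynomial (Fin (n + 3)) k))).comp
      (MvPolynomial.aeval (fun j : Fin (n + 1) => (X j.succ : MvPolynomial (Fin (n + 2)) k))) =
      MvPolynomial.aeval (fun j : Fin (n + 1) => (X j.succ.succ : MvPolynomial (Fin (n + 3)) k)) := by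
    refine MvPolynomial.algHom_ext fun j => ?_
    simp [Fin.cons_succ]
  exact AlgHom.congr_fun hc h

/-- `σ ∘ ι″ = id`. [folklore] -/
theorem sigma_comp_inclusion (s : MvPolynomial (Fin (n + 2)) k) :
    (MvPolynomial.aeval (Fin.cons (X 0) (Fin.cons (X 0) fun j : Fin (n + 1) => X j.succ) :
        Fin (n + 3) → MvPolynomial (Fin (n + 2)) k))
      ((MvPolynomial.aeval (Fin.cons (X 0) fun j : Fin (n + 1) => (X j.succ.succ : MvPolynomial (Fin (n + 3)) k))) s) = s := by
  have hc : (MvPolynomial.aeval (Fin.cons (X 0) (Fin.cons (X 0) fun j : Fin (n + 1) => X j.succ) :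
        Fin (n + 3) → MvPolynomial (Fin (n + 2)) k)).comp
      (MvPolynomial.aeval (Fin.cons (X 0) fun j : Fin (n + 1) => (X j.succ.succ : MvPolynomial (Fin (n + 3)) k))) =
      AlgHom.id k _ := by
    refine MvPolynomial.algHom_ext fun i => ?_
    refine Fin.cases ?_ (fun j => ?_) i
    · simp
    · simp [Fin.cons_succ]
  exact AlgHom.congr_fun hc s

/-- `g − ι″(σ g) ∈ (x − y)`. [folklore] -/
theorem sub_inclusion_sigma_mem (g : MvPolynomial (Fin (n + 3)) k) :
    g - (MvPolynomial.aeval (Fin.cons (X 0) fun j : Fin (n + 1) => (X j.succ.succ : MvPolynomial (Fin (n + 3)) k)))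
        ((MvPolynomial.aeval (Fin.cons (X 0) (Fin.cons (X 0) fun j : Fin (n + 1) => X j.succ) :
          Fin (n + 3) → MvPolynomial (Fin (n + 2)) k)) g) ∈
      Ideal.span ({X 0 - X 1} : Set (MvPolynomial (Fin (n + 3)) k)) := by
  induction g using MvPolynomial.induction_on with
  | C r => simp
  | add p q hp hq =>
    have : p + q - (MvPolynomial.aeval (Fin.cons (X 0) fun j : Fin (n + 1) => (X j.succ.succ : MvPolynomial (Fin (n + 3)) k)))
        ((MvPolynomial.aeval (Fin.cons (X 0) (Fin.cons (X 0) fun j : Fin (n + 1) => X j.succ) :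
          Fin (n + 3) → MvPolynomial (Fin (n + 2)) k)) (p + q)) =
        (p - (MvPolynomial.aeval (Fin.cons (X 0) fun j : Fin (n + 1) => (X j.succ.succ : MvPolynomial (Fin (n + 3)) k)))
          ((MvPolynomial.aeval (Fin.cons (X 0) (Fin.cons (X 0) fun j : Fin (n + 1) => X j.succ) :
            Fin (n + 3) → MvPolynomial (Fin (n + 2)) k)) p)) +
        (q - (MvPolynomial.aeval (Fin.cons (X 0) fun j : Fin (n + 1) => (X j.succ.succ : MvPolynomial (Fin (n + 3)) k)))
          ((MvPolynomial.aeval (Fin.cons (X 0) (Fin.cons (X 0) fun j : Fin (n + 1) => X j.succ) :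
            Fin (n + 3) → MvPolynomial (Fin (n + 2)) k)) q)) := by
      simp only [map_add]; ring
    rw [this]
    exact Ideal.add_mem _ hp hq
  | mul_X p i hp =>
    have hX : ∀ i : Fin (n + 3), (X i : MvPolynomial (Fin (n + 3)) k) -
        (MvPolynomial.aeval (Fin.cons (X 0) fun j : Fin (n + 1) => (X j.succ.succ : MvPolynomial (Fin (n + 3)) k)))
          ((MvPolynomial.aeval (Fin.cons (X 0) (Fin.cons (X 0) fun j : Fin (n + 1) => X j.succ) :
            Fin (n + 3) → MvPolynomial (Fin (n + 2)) k)) (X i : MvPolynomial (Fin (n + 3)) k)) ∈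
        Ideal.span ({X 0 - X 1} : Set (MvPolynomial (Fin (n + 3)) k)) := by
      intro i
      refine Fin.cases ?_ (fun i' => Fin.cases ?_ (fun j => ?_) i') i
      · simp
      · have h1 : (MvPolynomial.aeval (Fin.cons (X 0) fun j : Fin (n + 1) => (X j.succ.succ : MvPolynomial (Fin (n + 3)) k)))
            ((MvPolynomial.aeval (Fin.cons (X 0) (Fin.cons (X 0) fun j : Fin (n + 1) => X j.succ) :
              Fin (n + 3) → MvPolynomial (Fin (n + 2)) k)) (X (Fin.succ 0) : MvPolynomial (Fin (n + 3)) k)) = X 0 := by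
          simp [Fin.cons_zero]
        rw [h1, show (X (Fin.succ 0) - X 0 : MvPolynomial (Fin (n + 3)) k) = -(X 0 - X 1) by
          rw [neg_sub]; rfl]
        exact (Ideal.neg_mem_iff (Ideal.span ({X 0 - X 1} : Set (MvPolynomial (Fin (n + 3)) k)))).mpr
          (Ideal.mem_span_singleton_self (X 0 - X 1 : MvPolynomial (Fin (n + 3)) k))
      · simp [Fin.cons_succ]
    have : p * X i - (MvPolynomial.aeval (Fin.cons (X 0) fun j : Fin (n + 1) => (X j.succ.succ : MvPolynomial (Fin (n + 3)) k)))
        ((MvPolynomial.aeval (Fin.cons (X 0) (Fin.cons (X 0) fun j : Fin (n + 1) => X j.succ) :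
          Fin (n + 3) → MvPolynomial (Fin (n + 2)) k)) (p * X i)) =
        (p - (MvPolynomial.aeval (Fin.cons (X 0) fun j : Fin (n + 1) => (X j.succ.succ : MvPolynomial (Fin (n + 3)) k)))
          ((MvPolynomial.aeval (Fin.cons (X 0) (Fin.cons (X 0) fun j : Fin (n + 1) => X j.succ) :
            Fin (n + 3) → MvPolynomial (Fin (n + 2)) k)) p)) * X i +
        (MvPolynomial.aeval (Fin.cons (X 0) fun j : Fin (n + 1) => (X j.succ.succ : MvPolynomial (Fin (n + 3)) k)))
          ((MvPolynomial.aeval (Fin.cons (X 0) (Fin.cons (X 0) fun j : Fin (n + 1) => X j.succ) :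
            Fin (n + 3) → MvPolynomial (Fin (n + 2)) k)) p) *
          (X i - (MvPolynomial.aeval (Fin.cons (X 0) fun j : Fin (n + 1) => (X j.succ.succ : MvPolynomial (Fin (n + 3)) k)))
            ((MvPolynomial.aeval (Fin.cons (X 0) (Fin.cons (X 0) fun j : Fin (n + 1) => X j.succ) :
              Fin (n + 3) → MvPolynomial (Fin (n + 2)) k)) (X i : MvPolynomial (Fin (n + 3)) k))) := by
      simp only [map_mul]
      ring
    rw [this]
    exact Ideal.add_mem _ (Ideal.mul_mem_right _ _ hp) (Ideal.mul_mem_left _ _ (hX i))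

/-- `∂ₓ (ι h) = 0`. [folklore] -/
theorem pderiv_zero_inclusion (h : MvPolynomial (Fin (n + 1)) k) :
    MvPolynomial.pderiv 0 ((MvPolynomial.aeval (fun j : Fin (n + 1) => (X j.succ.succ : MvPolynomial (Fin (n + 3)) k))) h) = 0 :=
  pderiv_aeval_eq_zero k _ 0 (fun j => by simp [MvPolynomial.pderiv_X, Fin.succ_ne_zero]) h

/-- `∂_y (ι h) = 0`. [folklore] -/
theorem pderiv_one_inclusion (h : MvPolynomial (Fin (n + 1)) k) :
    MvPolynomial.pderiv 1 ((MvPolynomial.aeval (fun j : Fin (n + 1) => (X j.succ.succ : MvPolynomial (Fin (n + 3)) k))) h) = 0 :=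
  pderiv_aeval_eq_zero k _ 1 (fun j => by
    rw [MvPolynomial.pderiv_X]
    simp [show (j.succ.succ : Fin (n + 3)) ≠ 1 from fun h => by
      have := congrArg Fin.val h; simp at this]) h

/-- `σ f = F′`. [folklore] -/
theorem sigma_f (h : MvPolynomial (Fin (n + 1)) k) :
    (MvPolynomial.aeval (Fin.cons (X 0) (Fin.cons (X 0) fun j : Fin (n + 1) => X j.succ) :
        Fin (n + 3) → MvPolynomial (Fin (n + 2)) k))
        (X 0 * X 1 - (MvPolynomial.aeval (fun j : Fin (n + 1) => (X j.succ.succ : MvPolynomial (Fin (n + 3)) k))) h) =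
      X 0 ^ 2 - (MvPolynomial.aeval (fun j : Fin (n + 1) => (X j.succ : MvPolynomial (Fin (n + 2)) k))) h := by
  rw [map_sub, sigma_inclusion, map_mul, MvPolynomial.aeval_X, MvPolynomial.aeval_X, Fin.cons_zero,
    show (1 : Fin (n + 3)) = Fin.succ 0 from rfl, Fin.cons_succ, Fin.cons_zero, sq]

/-- `ι″ F′ = f + x (x − y)`. [folklore] -/
theorem inclusion_F' (h : MvPolynomial (Fin (n + 1)) k) :
    (MvPolynomial.aeval (Fin.cons (X 0) fun j : Fin (n + 1) => (X j.succ.succ : MvPolynomial (Fin (n + 3)) k)))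
        (X 0 ^ 2 - (MvPolynomial.aeval (fun j : Fin (n + 1) => (X j.succ : MvPolynomial (Fin (n + 2)) k))) h) =
      (X 0 * X 1 - (MvPolynomial.aeval (fun j : Fin (n + 1) => (X j.succ.succ : MvPolynomial (Fin (n + 3)) k))) h) +
        X 0 * (X 0 - X 1) := by
  rw [map_sub, inclusion_inclusion, map_pow, MvPolynomial.aeval_X, Fin.cons_zero]
  ring

/-- `∂_y f = x`. [folklore] -/
theorem pderiv_one_f (h : MvPolynomial (Fin (n + 1)) k) :
    MvPolynomial.pderiv 1 (X 0 * X 1 - (MvPolynomial.aeval (fun j : Fin (n + 1) =>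
      (X j.succ.succ : MvPolynomial (Fin (n + 3)) k))) h) = X 0 := by
  rw [map_sub, pderiv_one_inclusion, sub_zero]
  simp [Derivation.leibniz, MvPolynomial.pderiv_X]

/-- `∂ₓ f = y`. [folklore] -/
theorem pderiv_zero_f (h : MvPolynomial (Fin (n + 1)) k) :
    MvPolynomial.pderiv 0 (X 0 * X 1 - (MvPolynomial.aeval (fun j : Fin (n + 1) =>
      (X j.succ.succ : MvPolynomial (Fin (n + 3)) k))) h) = X 1 := by
  rw [map_sub, pderiv_zero_inclusion, sub_zero]
  simp [Derivation.leibniz, MvPolynomial.pderiv_X]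

/-- `f ≠ 0`. [folklore] -/
theorem f_ne_zero (h : MvPolynomial (Fin (n + 1)) k) :
    (X 0 * X 1 - (MvPolynomial.aeval (fun j : Fin (n + 1) => (X j.succ.succ : MvPolynomial (Fin (n + 3)) k))) h) ≠ 0 := by
  intro h0
  have h1 := congrArg (MvPolynomial.pderiv 1) h0
  rw [pderiv_one_f, map_zero] at h1
  exact MvPolynomial.X_ne_zero 0 h1

/-! ## §2 The first stage `T_h ↠ B_h` -/
/-- `x̄ − ȳ ∈ T_h⁰`. [folklore] -/
theorem mk_X0_sub_X1_mem_nonZeroDivisors (h2 : (2 : k) ≠ 0) (h : MvPolynomial (Fin (n + 1)) k) :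
    Ideal.Quotient.mk (Ideal.span ({X 0 * X 1 - (MvPolynomial.aeval (fun j : Fin (n + 1) =>
        (X j.succ.succ : MvPolynomial (Fin (n + 3)) k))) h} : Set (MvPolynomial (Fin (n + 3)) k))) (X 0 - X 1) ∈
      (MvPolynomial (Fin (n + 3)) k ⧸ Ideal.span ({X 0 * X 1 - (MvPolynomial.aeval (fun j : Fin (n + 1) =>
        (X j.succ.succ : MvPolynomial (Fin (n + 3)) k))) h} : Set (MvPolynomial (Fin (n + 3)) k)))⁰ := by
  refine mk_mem_nonZeroDivisors_of_ringHom
    (MvPolynomial.aeval (Fin.cons (X 0) (Fin.cons (X 0) fun j : Fin (n + 1) => X j.succ) :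
      Fin (n + 3) → MvPolynomial (Fin (n + 2)) k)).toRingHom
    (mem_nonZeroDivisors_of_ne_zero ?_) ?_ (fun q hq => ?_) ?_
  · intro h0
    have h1 := congrArg (MvPolynomial.pderiv 0) h0
    simp [MvPolynomial.pderiv_X] at h1
  · rw [AlgHom.toRingHom_eq_coe, RingHom.coe_coe, map_sub, MvPolynomial.aeval_X, MvPolynomial.aeval_X, Fin.cons_zero,
      show (1 : Fin (n + 3)) = Fin.succ 0 from rfl, Fin.cons_succ, Fin.cons_zero, sub_self]
  · have hq' := sub_inclusion_sigma_mem k n q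
    rw [AlgHom.toRingHom_eq_coe, RingHom.coe_coe] at hq
    rw [hq, map_zero, sub_zero] at hq'
    exact Ideal.mem_span_singleton.mp hq'
  · rw [AlgHom.toRingHom_eq_coe, RingHom.coe_coe, sigma_f]
    exact mem_nonZeroDivisors_of_ne_zero (F'_ne_zero k n h2 h)

/-- `x̄ ∈ caⁿ⁺³(T_h)` (`x = ∂f/∂y`). [folklore] -/
theorem mk_X0_mem_cohomologyAnnihilatorOfDegree (h : MvPolynomial (Fin (n + 1)) k) :
    Ideal.Quotient.mk (Ideal.span ({X 0 * X 1 - (MvPolynomial.aeval (fun j : Fin (n + 1) =>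
        (X j.succ.succ : MvPolynomial (Fin (n + 3)) k))) h} : Set (MvPolynomial (Fin (n + 3)) k))) (X 0) ∈
      cohomologyAnnihilatorOfDegree (MvPolynomial (Fin (n + 3)) k ⧸ Ideal.span ({X 0 * X 1 -
        (MvPolynomial.aeval (fun j : Fin (n + 1) => (X j.succ.succ : MvPolynomial (Fin (n + 3)) k))) h} :
          Set (MvPolynomial (Fin (n + 3)) k))) (n + 3) := by
  have hd : Ideal.Quotient.mk (Ideal.span ({X 0 * X 1 - (MvPolynomial.aeval (fun j : Fin (n + 1) =>
        (X j.succ.succ : MvPolynomial (Fin (n + 3)) k))) h} : Set (MvPolynomial (Fin (n + 3)) k))) (MvPolynomial.pderiv 1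
        (X 0 * X 1 - (MvPolynomial.aeval (fun j : Fin (n + 1) => (X j.succ.succ : MvPolynomial (Fin (n + 3)) k))) h)) ∈
      cohomologyAnnihilatorOfDegree (MvPolynomial (Fin (n + 3)) k ⧸ Ideal.span ({X 0 * X 1 -
        (MvPolynomial.aeval (fun j : Fin (n + 1) => (X j.succ.succ : MvPolynomial (Fin (n + 3)) k))) h} :
          Set (MvPolynomial (Fin (n + 3)) k))) (n + 3) :=
    pderiv_mem_cohomologyAnnihilatorOfDegree (d := n + 2) _ (f_ne_zero k n h) 1
  rwa [pderiv_one_f] at hd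

/-- `ȳ ∈ caⁿ⁺³(T_h)` (`y = ∂f/∂x`). [folklore] -/
theorem mk_X1_mem_cohomologyAnnihilatorOfDegree (h : MvPolynomial (Fin (n + 1)) k) :
    Ideal.Quotient.mk (Ideal.span ({X 0 * X 1 - (MvPolynomial.aeval (fun j : Fin (n + 1) =>
        (X j.succ.succ : MvPolynomial (Fin (n + 3)) k))) h} : Set (MvPolynomial (Fin (n + 3)) k))) (X 1) ∈
      cohomologyAnnihilatorOfDegree (MvPolynomial (Fin (n + 3)) k ⧸ Ideal.span ({X 0 * X 1 -
        (MvPolynomial.aeval (fun j : Fin (n + 1) => (X j.succ.succ : MvPolynomial (Fin (n + 3)) k))) h} :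
          Set (MvPolynomial (Fin (n + 3)) k))) (n + 3) := by
  have hd : Ideal.Quotient.mk (Ideal.span ({X 0 * X 1 - (MvPolynomial.aeval (fun j : Fin (n + 1) =>
        (X j.succ.succ : MvPolynomial (Fin (n + 3)) k))) h} : Set (MvPolynomial (Fin (n + 3)) k))) (MvPolynomial.pderiv 0
        (X 0 * X 1 - (MvPolynomial.aeval (fun j : Fin (n + 1) => (X j.succ.succ : MvPolynomial (Fin (n + 3)) k))) h)) ∈
      cohomologyAnnihilatorOfDegree (MvPolynomial (Fin (n + 3)) k ⧸ Ideal.span ({X 0 * X 1 -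
        (MvPolynomial.aeval (fun j : Fin (n + 1) => (X j.succ.succ : MvPolynomial (Fin (n + 3)) k))) h} :
          Set (MvPolynomial (Fin (n + 3)) k))) (n + 3) :=
    pderiv_mem_cohomologyAnnihilatorOfDegree (d := n + 2) _ (f_ne_zero k n h) 0
  rwa [pderiv_zero_f] at hd

/-- **`T_h ↠ B_h`** with kernel `(x̄ − ȳ)`, values `(σ g)‾`. [OURS · L1 w44b] -/
theorem exists_ringHom_middleStage (h : MvPolynomial (Fin (n + 1)) k) :
    ∃ Ψ : (MvPolynomial (Fin (n + 3)) k ⧸ Ideal.span ({X 0 * X 1 - (MvPolynomial.aeval (fun j : Fin (n + 1) =>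
        (X j.succ.succ : MvPolynomial (Fin (n + 3)) k))) h} : Set (MvPolynomial (Fin (n + 3)) k))) →+*
        (MvPolynomial (Fin (n + 2)) k ⧸ Ideal.span ({X 0 ^ 2 - (MvPolynomial.aeval (fun j : Fin (n + 1) =>
          (X j.succ : MvPolynomial (Fin (n + 2)) k))) h} : Set (MvPolynomial (Fin (n + 2)) k))),
      Function.Surjective Ψ ∧ RingHom.ker Ψ = Ideal.span {Ideal.Quotient.mk _ (X 0 - X 1)} ∧
      ∀ g : MvPolynomial (Fin (n + 3)) k, Ψ (Ideal.Quotient.mk _ g) =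
        Ideal.Quotient.mk _ ((MvPolynomial.aeval (Fin.cons (X 0) (Fin.cons (X 0) fun j : Fin (n + 1) => X j.succ) :
          Fin (n + 3) → MvPolynomial (Fin (n + 2)) k)) g) := by
  set Ψ₀ : MvPolynomial (Fin (n + 3)) k →+* (MvPolynomial (Fin (n + 2)) k ⧸ Ideal.span ({X 0 ^ 2 -
      (MvPolynomial.aeval (fun j : Fin (n + 1) => (X j.succ : MvPolynomial (Fin (n + 2)) k))) h} :
        Set (MvPolynomial (Fin (n + 2)) k))) :=
    (Ideal.Quotient.mk _).comp (MvPolynomial.aeval (Fin.cons (X 0) (Fin.cons (X 0) fun j : Fin (n + 1) => X j.succ) :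
      Fin (n + 3) → MvPolynomial (Fin (n + 2)) k)).toRingHom with hΨ₀
  have hΨ₀_apply : ∀ g, Ψ₀ g = Ideal.Quotient.mk _ ((MvPolynomial.aeval (Fin.cons (X 0) (Fin.cons (X 0)
      fun j : Fin (n + 1) => X j.succ) : Fin (n + 3) → MvPolynomial (Fin (n + 2)) k)) g) := fun g => rfl
  have hΨ₀f : ∀ a ∈ Ideal.span ({X 0 * X 1 - (MvPolynomial.aeval (fun j : Fin (n + 1) =>
      (X j.succ.succ : MvPolynomial (Fin (n + 3)) k))) h} : Set (MvPolynomial (Fin (n + 3)) k)), Ψ₀ a = 0 := by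
    intro a ha
    obtain ⟨v, rfl⟩ := Ideal.mem_span_singleton'.mp ha
    rw [map_mul, hΨ₀_apply (X 0 * X 1 - _), sigma_f, Ideal.Quotient.eq_zero_iff_mem.mpr (Ideal.mem_span_singleton_self _),
      mul_zero]
  set Ψ := Ideal.Quotient.lift _ Ψ₀ hΨ₀f with hΨ
  have hΨ_mk : ∀ g, Ψ (Ideal.Quotient.mk _ g) = Ψ₀ g := fun g => Ideal.Quotient.lift_mk _ _ _
  refine ⟨Ψ, ?_, ?_, fun g => by rw [hΨ_mk, hΨ₀_apply]⟩
  · intro u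
    obtain ⟨g, rfl⟩ := Ideal.Quotient.mk_surjective u
    exact ⟨Ideal.Quotient.mk _ ((MvPolynomial.aeval (Fin.cons (X 0) fun j : Fin (n + 1) =>
      (X j.succ.succ : MvPolynomial (Fin (n + 3)) k))) g), by rw [hΨ_mk, hΨ₀_apply, sigma_comp_inclusion]⟩
  · apply le_antisymm
    · intro u hu
      obtain ⟨g, rfl⟩ := Ideal.Quotient.mk_surjective u
      rw [RingHom.mem_ker, hΨ_mk, hΨ₀_apply, Ideal.Quotient.eq_zero_iff_mem, Ideal.mem_span_singleton'] at hu
      obtain ⟨r, hr⟩ := hu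
      have hmem : g - (MvPolynomial.aeval (Fin.cons (X 0) fun j : Fin (n + 1) => (X j.succ.succ : MvPolynomial (Fin (n + 3)) k))) r *
          (X 0 * X 1 - (MvPolynomial.aeval (fun j : Fin (n + 1) => (X j.succ.succ : MvPolynomial (Fin (n + 3)) k))) h) ∈
          Ideal.span ({X 0 - X 1} : Set (MvPolynomial (Fin (n + 3)) k)) := by
        have h1 := sub_inclusion_sigma_mem k n g
        rw [← hr, map_mul, inclusion_F'] at h1
        have hid : g - (MvPolynomial.aeval (Fin.cons (X 0) fun j : Fin (n + 1) =>
              (X j.succ.succ : MvPolynomial (Fin (n + 3)) k))) r *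
            (X 0 * X 1 - (MvPolynomial.aeval (fun j : Fin (n + 1) => (X j.succ.succ : MvPolynomial (Fin (n + 3)) k))) h) =
            (g - (MvPolynomial.aeval (Fin.cons (X 0) fun j : Fin (n + 1) =>
                (X j.succ.succ : MvPolynomial (Fin (n + 3)) k))) r *
              ((X 0 * X 1 - (MvPolynomial.aeval (fun j : Fin (n + 1) =>
                  (X j.succ.succ : MvPolynomial (Fin (n + 3)) k))) h) + X 0 * (X 0 - X 1))) +
            (MvPolynomial.aeval (Fin.cons (X 0) fun j : Fin (n + 1) =>
                (X j.succ.succ : MvPolynomial (Fin (n + 3)) k))) r * X 0 * (X 0 - X 1) := by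
          ring
        rw [hid]
        exact Ideal.add_mem _ h1 (Ideal.mul_mem_left _ _ (Ideal.mem_span_singleton_self _))
      have heq : Ideal.Quotient.mk (Ideal.span ({X 0 * X 1 - (MvPolynomial.aeval (fun j : Fin (n + 1) =>
            (X j.succ.succ : MvPolynomial (Fin (n + 3)) k))) h} : Set (MvPolynomial (Fin (n + 3)) k))) g =
          Ideal.Quotient.mk _ (g - (MvPolynomial.aeval (Fin.cons (X 0) fun j : Fin (n + 1) =>
              (X j.succ.succ : MvPolynomial (Fin (n + 3)) k))) r *
            (X 0 * X 1 - (MvPolynomial.aeval (fun j : Fin (n + 1) => (X j.succ.succ : MvPolynomial (Fin (n + 3)) k))) h)) := by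
        rw [Ideal.Quotient.eq]
        have : g - (g - (MvPolynomial.aeval (Fin.cons (X 0) fun j : Fin (n + 1) =>
              (X j.succ.succ : MvPolynomial (Fin (n + 3)) k))) r *
            (X 0 * X 1 - (MvPolynomial.aeval (fun j : Fin (n + 1) => (X j.succ.succ : MvPolynomial (Fin (n + 3)) k))) h)) =
            (MvPolynomial.aeval (Fin.cons (X 0) fun j : Fin (n + 1) =>
                (X j.succ.succ : MvPolynomial (Fin (n + 3)) k))) r *
              (X 0 * X 1 - (MvPolynomial.aeval (fun j : Fin (n + 1) => (X j.succ.succ : MvPolynomial (Fin (n + 3)) k))) h) := by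
          ring
        rw [this]
        exact Ideal.mul_mem_left _ _ (Ideal.mem_span_singleton_self _)
      have hmap : (Ideal.span ({X 0 - X 1} : Set (MvPolynomial (Fin (n + 3)) k))).map
          (Ideal.Quotient.mk (Ideal.span ({X 0 * X 1 - (MvPolynomial.aeval (fun j : Fin (n + 1) =>
            (X j.succ.succ : MvPolynomial (Fin (n + 3)) k))) h} : Set (MvPolynomial (Fin (n + 3)) k)))) =
          Ideal.span {Ideal.Quotient.mk (Ideal.span ({X 0 * X 1 - (MvPolynomial.aeval (fun j : Fin (n + 1) =>
            (X j.succ.succ : MvPolynomial (Fin (n + 3)) k))) h} : Set (MvPolynomial (Fin (n + 3)) k))) (X 0 - X 1)} := by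
        rw [Ideal.map_span, Set.image_singleton]
      rw [heq, ← hmap]
      exact Ideal.mem_map_of_mem _ hmem
    · rw [Ideal.span_le, Set.singleton_subset_iff, SetLike.mem_coe, RingHom.mem_ker, hΨ_mk, hΨ₀_apply]
      have h0 : (MvPolynomial.aeval (Fin.cons (X 0) (Fin.cons (X 0) fun j : Fin (n + 1) => X j.succ) :
          Fin (n + 3) → MvPolynomial (Fin (n + 2)) k)) (X 0 - X 1 : MvPolynomial (Fin (n + 3)) k) = 0 := by
        rw [map_sub, MvPolynomial.aeval_X, MvPolynomial.aeval_X, Fin.cons_zero, show (1 : Fin (n + 3)) = Fin.succ 0 from rfl,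
          Fin.cons_succ, Fin.cons_zero, sub_self]
      rw [h0, map_zero]

/-! ## §3 The arena lower bound in every dimension -/
/-- **ARENA LOWER BOUND, every dimension (OURS · L1 w44b), fact-free**: `k` a field with `2 ≠ 0`, `0 ≠ h ∈ k[z₁,…,z_{n+1}]`,
`c̄ ∈ caⁿ⁺¹(k[z]/(h))` ⇒ `(ι c)‾ ∈ caⁿ⁺³(k[x,y,z]/(xy − ι h))`. -/
theorem mk_inclusion_mem_cohomologyAnnihilatorOfDegree (h2 : (2 : k) ≠ 0) (h : MvPolynomial (Fin (n + 1)) k) (hh : h ≠ 0)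
    (c : MvPolynomial (Fin (n + 1)) k)
    (hc : Ideal.Quotient.mk (Ideal.span ({h} : Set (MvPolynomial (Fin (n + 1)) k))) c ∈
      cohomologyAnnihilatorOfDegree (MvPolynomial (Fin (n + 1)) k ⧸ Ideal.span ({h} : Set (MvPolynomial (Fin (n + 1)) k))) (n + 1)) :
    Ideal.Quotient.mk (Ideal.span ({X 0 * X 1 - (MvPolynomial.aeval (fun j : Fin (n + 1) =>
        (X j.succ.succ : MvPolynomial (Fin (n + 3)) k))) h} : Set (MvPolynomial (Fin (n + 3)) k)))
        ((MvPolynomial.aeval (fun j : Fin (n + 1) => (X j.succ.succ : MvPolynomial (Fin (n + 3)) k))) c) ∈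
      cohomologyAnnihilatorOfDegree (MvPolynomial (Fin (n + 3)) k ⧸ Ideal.span ({X 0 * X 1 -
        (MvPolynomial.aeval (fun j : Fin (n + 1) => (X j.succ.succ : MvPolynomial (Fin (n + 3)) k))) h} :
          Set (MvPolynomial (Fin (n + 3)) k))) (n + 3) := by
  have hB := ArenaGeneralMiddle.mk_inclusion_mem_cohomologyAnnihilatorOfDegree k n h2 h hh c hc
  have ha := Ideal.sub_mem _ (mk_X0_mem_cohomologyAnnihilatorOfDegree k n h) (mk_X1_mem_cohomologyAnnihilatorOfDegree k n h)
  rw [← map_sub] at ha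
  obtain ⟨Ψ, hsurj, hker, hΨ⟩ := exists_ringHom_middleStage k n h
  refine mem_cohomologyAnnihilatorOfDegree_of_surjective Ψ hsurj hker (mk_X0_sub_X1_mem_nonZeroDivisors k n h2 h)
    (m := n + 1) ha ?_
  rw [hΨ, sigma_inclusion]
  exact hB

/-- **Ideal form**: `((x, y) + ι((caⁿ⁺¹ C_h).comap mk))·T_h ≤ caⁿ⁺³(T_h)`. [OURS · L1 w44b] -/
theorem map_le_cohomologyAnnihilatorOfDegree (h2 : (2 : k) ≠ 0) (h : MvPolynomial (Fin (n + 1)) k) (hh : h ≠ 0) :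
    (Ideal.span ({X 0, X 1} : Set (MvPolynomial (Fin (n + 3)) k)) ⊔
        ((cohomologyAnnihilatorOfDegree (MvPolynomial (Fin (n + 1)) k ⧸
            Ideal.span ({h} : Set (MvPolynomial (Fin (n + 1)) k))) (n + 1)).comap
          (Ideal.Quotient.mk (Ideal.span ({h} : Set (MvPolynomial (Fin (n + 1)) k))))).map
          (MvPolynomial.aeval (fun j : Fin (n + 1) => (X j.succ.succ : MvPolynomial (Fin (n + 3)) k))).toRingHom).map
        (Ideal.Quotient.mk (Ideal.span ({X 0 * X 1 - (MvPolynomial.aeval (fun j : Fin (n + 1) =>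
          (X j.succ.succ : MvPolynomial (Fin (n + 3)) k))) h} : Set (MvPolynomial (Fin (n + 3)) k)))) ≤
      cohomologyAnnihilatorOfDegree (MvPolynomial (Fin (n + 3)) k ⧸ Ideal.span ({X 0 * X 1 -
        (MvPolynomial.aeval (fun j : Fin (n + 1) => (X j.succ.succ : MvPolynomial (Fin (n + 3)) k))) h} :
          Set (MvPolynomial (Fin (n + 3)) k))) (n + 3) := by
  rw [Ideal.map_sup, sup_le_iff]
  constructor
  · rw [Ideal.map_span, Ideal.span_le]
    rintro _ ⟨g, hg, rfl⟩
    simp only [Set.mem_insert_iff, Set.mem_singleton_iff] at hg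
    rcases hg with rfl | rfl
    · exact mk_X0_mem_cohomologyAnnihilatorOfDegree k n h
    · exact mk_X1_mem_cohomologyAnnihilatorOfDegree k n h
  · rw [Ideal.map_map, Ideal.map_le_iff_le_comap]
    intro c hc
    rw [Ideal.mem_comap] at hc ⊢
    exact mk_inclusion_mem_cohomologyAnnihilatorOfDegree k n h2 h hh c hc

/-- Localised form at any `IsLocalization M T` of `T_h` (e.g. the local ring at the origin). [OURS · L1 w44b] -/
theorem map_map_le_cohomologyAnnihilatorOfDegree_of_isLocalization (h2 : (2 : k) ≠ 0) (h : MvPolynomial (Fin (n + 1)) k)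
    (hh : h ≠ 0)
    (M : Submonoid (MvPolynomial (Fin (n + 3)) k ⧸ Ideal.span ({X 0 * X 1 - (MvPolynomial.aeval (fun j : Fin (n + 1) =>
      (X j.succ.succ : MvPolynomial (Fin (n + 3)) k))) h} : Set (MvPolynomial (Fin (n + 3)) k))))
    (T : Type u) [CommRing T]
    [Algebra (MvPolynomial (Fin (n + 3)) k ⧸ Ideal.span ({X 0 * X 1 - (MvPolynomial.aeval (fun j : Fin (n + 1) =>
      (X j.succ.succ : MvPolynomial (Fin (n + 3)) k))) h} : Set (MvPolynomial (Fin (n + 3)) k))) T] [IsLocalization M T] :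
    ((Ideal.span ({X 0, X 1} : Set (MvPolynomial (Fin (n + 3)) k)) ⊔
        ((cohomologyAnnihilatorOfDegree (MvPolynomial (Fin (n + 1)) k ⧸
            Ideal.span ({h} : Set (MvPolynomial (Fin (n + 1)) k))) (n + 1)).comap
          (Ideal.Quotient.mk (Ideal.span ({h} : Set (MvPolynomial (Fin (n + 1)) k))))).map
          (MvPolynomial.aeval (fun j : Fin (n + 1) => (X j.succ.succ : MvPolynomial (Fin (n + 3)) k))).toRingHom).map
        (Ideal.Quotient.mk (Ideal.span ({X 0 * X 1 - (MvPolynomial.aeval (fun j : Fin (n + 1) =>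
          (X j.succ.succ : MvPolynomial (Fin (n + 3)) k))) h} : Set (MvPolynomial (Fin (n + 3)) k))))).map
        (algebraMap (MvPolynomial (Fin (n + 3)) k ⧸ Ideal.span ({X 0 * X 1 - (MvPolynomial.aeval (fun j : Fin (n + 1) =>
          (X j.succ.succ : MvPolynomial (Fin (n + 3)) k))) h} : Set (MvPolynomial (Fin (n + 3)) k))) T) ≤
      cohomologyAnnihilatorOfDegree T (n + 3) :=
  (Ideal.map_mono (map_le_cohomologyAnnihilatorOfDegree k n h2 h hh)).trans
    (map_cohomologyAnnihilatorOfDegree_le_of_isLocalization M T (n + 3))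

end Summit.ResolutionOfSingularities.ResolutionOfSingularities.Theorems.HomologicalConductor.ArenaGeneral

end
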